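import Mathlib
import Summits.NavierStokesRegularity.NavierStokesRegularity.Theorems.RootDecompLitSliceLocalEnergyFlux
import Summits.NavierStokesRegularity.NavierStokesRegularity.Theorems.RootDecompLitSliceLocalWindowTradeoff
import HarnessLib

/-!
# Route RootDecompLitSlice — cell Uᶜ `CritTameScarIsCritical` (stmt-NavierStokesRegularity-31733):
# the TERMINAL-WINDOW local energy budget — STℓ with the dissipation number discharged

Helpers toward the Tao-vacuous cell Uᶜ (`--supports 31733`; no item, no node, no registered stub).
Second half of the discharge of the dissipation number `L` of STℓ
(`LocalWindowTradeoff.localWindowTradeoff`), built on `LocalEnergyBudget.dissipation_le_window`: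

* `LocalEnergyBudget.release_le_of_modulus` — the RELEASE TERM from the window modulus alone: for
  `L²` fields `a, b, z` of `ℝ³` with `∫|a−z|², ∫|b−z|² ≤ H` and a weight `0 ≤ φ ≤ 1` vanishing off
  `B(x₀,R)`: `∫φ|a|² − ∫φ|b|² ≤ 4H + 4√H·(2H + 2∫_{B(x₀,R)}|z|²)^{1/2}`;
* `LocalEnergyBudget.terminalLocalDissipation_le` — classical frame `[0,T)`, `φ = 1` on `B_ρ(x₀)`,
  `0 < τ < T`, a release bound `Rel` and budgets `a, m₃, m_{pu}` on every sub-window `(T−τ,t₁)`,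
  `t₁ < T`: `∫⁻_{(T−τ,T)}∫⁻_{B_ρ(x₀)}|∇u|²_F ≤ (Rel + νC_L a τ + C_g m₃ + 2C_g m_{pu})/(2ν)`
  (`[0,∞]`-valued; sub-windows + exhaustion `t₁ ↑ T`, nothing assumed at the blow-up time);
* `LocalEnergyBudget.scar_le_of_fluxBudget` — ★ STℓ WITH THE BUDGET DISCHARGED: on the classical
  Leray–Hopf frame with window modulus `∫|u(t)−u(T)|² ≤ H` on `[T−τ,T)`,
  `∫_{B_r(x₀)}|u(T)|² ≤ 2H + 16(r²/(ντ))·L + c₀(r/ρ)²(H + ∫_{B_ρ(x₀)}|u(T)|²)`,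
  `L = ½(4H + 4√H(2H + 2∫_{B_R(x₀)}|u(T)|²)^{1/2} + νC_L a τ + C_g m₃ + 2C_g m_{pu})`:
  the scar mass is paid by the modulus, the tail, the Laplacian term and the CUBIC and gauged
  PRESSURE FLUXES `m₃ ≥ sup_{t₁<T}∬_{(T−τ,t₁)×B_R}|u|³`, `m_{pu} ≥ sup ∬|p − c(t)||u|` through the
  collar — explicit hypothesis NUMBERS bounding explicit integrals (critic row 665 (c3)).

NOT here (open, FLUXSTARVED-g38 §4): any bound on `m₃`, `m_{pu}` from the frame (`m₃` is
scale-critical; `m_{pu}` needs a Riesz pressure, in tree only for Kato solutions).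
HONEST FRAMING: helper lemmas INSIDE the Tao-vacuous cell Uᶜ; zero load of the route moves
(ROOT ⟺ U ∧ P1, critic rows 354/371/563/639/665); no item is re-typed. Rung 0: nothing here proves
NS regularity. Decomp-ns route-writer g39. [folklore]
-/

set_option linter.dupNamespace false

noncomputable section

namespace Summit.NavierStokesRegularity.NavierStokesRegularity.Theorems

open MeasureTheory TopologicalSpace Set Function Filter Metric
open _root_.Topology
open scoped Laplacian InnerProductSpace RealInnerProductSpace ENNReal NNReal ContDiff
open Literature.Analysis.FluidPDE

namespace LocalEnergyBudget

/-- For `φ ≥ 0` and a field `a`, `‖√φ • a‖² = φ‖a‖²` pointwise. [folklore] -/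
theorem norm_sqrt_smul_sq {E : Type*} [NormedAddCommGroup E] [NormedSpace ℝ E]
    {φ : ℝ} (hφ : 0 ≤ φ) (v : E) : ‖Real.sqrt φ • v‖ ^ 2 = φ * ‖v‖ ^ 2 := by
  rw [norm_smul, Real.norm_eq_abs, abs_of_nonneg (Real.sqrt_nonneg _), mul_pow,
    Real.sq_sqrt hφ]

/-- **The local energy release is paid by the window modulus.** For `L²` fields `a, b, z` of `ℝ³`
with `∫⁻‖a − z‖ₑ² ≤ H`, `∫⁻‖b − z‖ₑ² ≤ H`, and a continuous weight `0 ≤ φ ≤ 1` vanishing off the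
ball `B(x₀,R)`:
`∫φ|a|² − ∫φ|b|² ≤ 4H + 4√H·(2H + 2∫_{B(x₀,R)}|z|²)^{1/2}`
(Minkowski in `L²(φ dx)` for `√φ·a = √φ·b + √φ·(a − b)`, `‖a − b‖₂ ≤ 2√H`, and the approximation
principle `∫_{B_R}|b|² ≤ 2H + 2∫_{B_R}|z|²`). In the route: `a = u(T−τ)`, `b = u(t₁)`, `z = u(T)`.
[folklore] -/
theorem release_le_of_modulus (a b z : EuclideanSpace ℝ (Fin 3) → EuclideanSpace ℝ (Fin 3))
    (ha : MemLp a 2 volume) (hb : MemLp b 2 volume) (hz : MemLp z 2 volume)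
    {φ : EuclideanSpace ℝ (Fin 3) → ℝ} (hφm : Continuous φ) (hφ0 : ∀ x, 0 ≤ φ x)
    (hφ1 : ∀ x, φ x ≤ 1) {x₀ : EuclideanSpace ℝ (Fin 3)} {R : ℝ}
    (hsupp : ∀ x, x ∉ ball x₀ R → φ x = 0)
    {H : ℝ} (hH : 0 ≤ H) (haz : ∫⁻ x, ‖a x - z x‖ₑ ^ 2 ≤ ENNReal.ofReal H)
    (hbz : ∫⁻ x, ‖b x - z x‖ₑ ^ 2 ≤ ENNReal.ofReal H) :
    (∫ x, φ x * ‖a x‖ ^ 2) - ∫ x, φ x * ‖b x‖ ^ 2 ≤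
      4 * H + 4 * Real.sqrt H * Real.sqrt (2 * H + 2 * ∫ x in ball x₀ R, ‖z x‖ ^ 2) := by
  -- the weighted fields
  set v : EuclideanSpace ℝ (Fin 3) → EuclideanSpace ℝ (Fin 3) :=
    fun x => Real.sqrt (φ x) • a x with hv
  set w : EuclideanSpace ℝ (Fin 3) → EuclideanSpace ℝ (Fin 3) :=
    fun x => Real.sqrt (φ x) • b x with hw
  have hsqrt1 : ∀ x, Real.sqrt (φ x) ≤ 1 := fun x => Real.sqrt_le_one.mpr (hφ1 x) |>.trans_eq' rfl
  have hsm : Continuous fun x => Real.sqrt (φ x) := Real.continuous_sqrt.comp hφm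
  have hvle : ∀ x, ‖v x‖ ≤ ‖a x‖ := fun x => by
    rw [hv]; dsimp only
    rw [norm_smul, Real.norm_eq_abs, abs_of_nonneg (Real.sqrt_nonneg _)]
    exact (mul_le_mul_of_nonneg_right (hsqrt1 x) (norm_nonneg _)).trans_eq (one_mul _)
  have hwle : ∀ x, ‖w x‖ ≤ ‖b x‖ := fun x => by
    rw [hw]; dsimp only
    rw [norm_smul, Real.norm_eq_abs, abs_of_nonneg (Real.sqrt_nonneg _)]
    exact (mul_le_mul_of_nonneg_right (hsqrt1 x) (norm_nonneg _)).trans_eq (one_mul _)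
  have hvm : MemLp v 2 volume :=
    MemLp.of_le ha (hsm.aestronglyMeasurable.smul ha.1) (Eventually.of_forall hvle)
  have hwm : MemLp w 2 volume :=
    MemLp.of_le hb (hsm.aestronglyMeasurable.smul hb.1) (Eventually.of_forall hwle)
  -- pointwise identities
  have hv2 : ∀ x, ‖v x‖ ^ 2 = φ x * ‖a x‖ ^ 2 := fun x => norm_sqrt_smul_sq (hφ0 x) (a x)
  have hw2 : ∀ x, ‖w x‖ ^ 2 = φ x * ‖b x‖ ^ 2 := fun x => norm_sqrt_smul_sq (hφ0 x) (b x)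
  -- the modulus between `w` and `v`: `∫⁻‖w − v‖ₑ² ≤ 4H`
  have hmod4 : ∫⁻ x, ‖w x - v x‖ₑ ^ 2 ≤ ENNReal.ofReal (4 * H) := by
    -- `‖b − a‖₂ ≤ ‖b − z‖₂ + ‖z − a‖₂ ≤ 2√H`
    have hbz' : eLpNorm (b - z) 2 volume ≤ ENNReal.ofReal (Real.sqrt H) := by
      rw [PowerGaugeEulerLiouville.Backward.eLpNorm_two_eq_sqrt, Real.sqrt_eq_rpow,
        ← ENNReal.ofReal_rpow_of_nonneg hH (by norm_num)]
      exact ENNReal.rpow_le_rpow (by simpa only [Pi.sub_apply] using hbz) (by norm_num)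
    have hza' : eLpNorm (z - a) 2 volume ≤ ENNReal.ofReal (Real.sqrt H) := by
      rw [PowerGaugeEulerLiouville.Backward.eLpNorm_two_eq_sqrt, Real.sqrt_eq_rpow,
        ← ENNReal.ofReal_rpow_of_nonneg hH (by norm_num)]
      refine ENNReal.rpow_le_rpow ?_ (by norm_num)
      calc ∫⁻ x, ‖(z - a) x‖ₑ ^ 2 = ∫⁻ x, ‖a x - z x‖ₑ ^ 2 := by
            refine lintegral_congr fun x => ?_
            rw [Pi.sub_apply, ← enorm_neg, neg_sub]
        _ ≤ ENNReal.ofReal H := haz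
    have htri : eLpNorm (b - a) 2 volume ≤ ENNReal.ofReal (Real.sqrt H + Real.sqrt H) := by
      have hsum : b - a = (b - z) + (z - a) := by abel
      rw [hsum, ENNReal.ofReal_add (Real.sqrt_nonneg _) (Real.sqrt_nonneg _)]
      exact (eLpNorm_add_le (hb.1.sub hz.1) (hz.1.sub ha.1) (by norm_num)).trans
        (add_le_add hbz' hza')
    have hsq := PowerGaugeEulerLiouville.Backward.lintegral_enorm_sq_le_of_eLpNorm_le htri
    rw [← ENNReal.ofReal_pow (add_nonneg (Real.sqrt_nonneg _) (Real.sqrt_nonneg _))] at hsq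
    have h4 : (Real.sqrt H + Real.sqrt H) ^ 2 = 4 * H := by
      nlinarith [Real.sq_sqrt hH]
    rw [h4] at hsq
    -- `‖w − v‖ₑ ≤ ‖b − a‖ₑ` pointwise
    calc ∫⁻ x, ‖w x - v x‖ₑ ^ 2 ≤ ∫⁻ x, ‖(b - a) x‖ₑ ^ 2 := by
          refine lintegral_mono fun x => ?_
          gcongr
          rw [Pi.sub_apply, hw, hv]
          dsimp only
          rw [← smul_sub, enorm_smul]
          calc ‖Real.sqrt (φ x)‖ₑ * ‖b x - a x‖ₑ ≤ 1 * ‖b x - a x‖ₑ := by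
                gcongr
                rw [← ofReal_norm, Real.norm_eq_abs, abs_of_nonneg (Real.sqrt_nonneg _)]
                exact ENNReal.ofReal_le_one.2 (hsqrt1 x)
            _ = ‖b x - a x‖ₑ := one_mul _
      _ ≤ ENNReal.ofReal (4 * H) := hsq
  -- the weighted mass of `b` as a real number
  obtain ⟨Pb, hPbdef⟩ : ∃ Pb : ℝ, Pb = ∫ x, φ x * ‖b x‖ ^ 2 := ⟨_, rfl⟩
  have hPb0 : 0 ≤ Pb := by
    rw [hPbdef]; exact integral_nonneg fun x => mul_nonneg (hφ0 x) (sq_nonneg _)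
  -- `∫_{B_R}‖w‖² = ∫ φ|b|²` and `∫_{B_R}‖v‖² = ∫ φ|a|²`
  have hwB : ∫ x in ball x₀ R, ‖w x‖ ^ 2 = Pb := by
    rw [hPbdef, setIntegral_eq_integral_of_forall_compl_eq_zero fun x hx => by
      rw [hw2 x, hsupp x hx, zero_mul]]
    exact integral_congr_ae (Eventually.of_forall fun x => hw2 x)
  have hvB : ∫ x in ball x₀ R, ‖v x‖ ^ 2 = ∫ x, φ x * ‖a x‖ ^ 2 := by
    rw [setIntegral_eq_integral_of_forall_compl_eq_zero fun x hx => by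
      rw [hv2 x, hsupp x hx, zero_mul]]
    exact integral_congr_ae (Eventually.of_forall fun x => hv2 x)
  -- the sharp approximation principle for `(v, w)` on `B_R`
  have h4H : 0 ≤ 4 * H := by positivity
  have hkey := LocalWindowTradeoff.localMass_le_sq_sqrt_add v w hvm hwm x₀ R h4H hPb0 hmod4
    hwB.le
  rw [hvB] at hkey
  -- `Pb ≤ 2H + 2 ∫_{B_R}|z|²`
  obtain ⟨m, hmdef⟩ : ∃ m : ℝ, m = ∫ x in ball x₀ R, ‖z x‖ ^ 2 := ⟨_, rfl⟩
  have hm0 : 0 ≤ m := by rw [hmdef]; exact integral_nonneg fun _ => sq_nonneg _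
  have hzb : ∫⁻ x, ‖z x - b x‖ₑ ^ 2 ≤ ENNReal.ofReal H := by
    calc ∫⁻ x, ‖z x - b x‖ₑ ^ 2 = ∫⁻ x, ‖b x - z x‖ₑ ^ 2 := by
          refine lintegral_congr fun x => ?_
          rw [← enorm_neg, neg_sub]
      _ ≤ ENNReal.ofReal H := hbz
  have hbR : ∫ x in ball x₀ R, ‖b x‖ ^ 2 ≤ 2 * H + 2 * m :=
    SupRateClockScarLaw.scar_le_two_clock_add_two_localMass b z hb hz x₀ R hH hm0 hzb
      (by rw [hmdef])
  have hPble : Pb ≤ 2 * H + 2 * m := by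
    rw [← hwB]
    refine le_trans ?_ hbR
    refine setIntegral_mono_on (hwm.integrable_norm_pow two_ne_zero).integrableOn
      (hb.integrable_norm_pow two_ne_zero).integrableOn measurableSet_ball fun x _ => ?_
    exact pow_le_pow_left₀ (norm_nonneg _) (hwle x) 2
  rw [← hmdef, ← hPbdef]
  -- expand `(√(4H) + √Pb)²` and compare
  have hs4 : Real.sqrt (4 * H) = 2 * Real.sqrt H := by
    rw [Real.sqrt_mul (by norm_num : (0:ℝ) ≤ 4), show (4 : ℝ) = 2 ^ 2 by norm_num,
      Real.sqrt_sq (by norm_num : (0:ℝ) ≤ 2)]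
  have hexp : (Real.sqrt (4 * H) + Real.sqrt Pb) ^ 2 =
      4 * H + 4 * Real.sqrt H * Real.sqrt Pb + Pb := by
    rw [hs4, add_sq, Real.sq_sqrt hPb0]
    nlinarith [Real.sq_sqrt hH]
  have hsqle : Real.sqrt Pb ≤ Real.sqrt (2 * H + 2 * m) := Real.sqrt_le_sqrt hPble
  have hprod : 4 * Real.sqrt H * Real.sqrt Pb ≤ 4 * Real.sqrt H * Real.sqrt (2 * H + 2 * m) :=
    mul_le_mul_of_nonneg_left hsqle (by positivity)
  linarith

/-- **Local dissipation over the TERMINAL window, `[0,∞]`-valued.** Classical solution on `[0,T)`;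
`φ ∈ C_c^∞(ℝ³)`, `φ ≥ 0`, `φ = 1` on `B_ρ(x₀)`, `tsupport φ ⊆ B_R(x₀)`, `‖Dφ‖ ≤ C_g`, `|Δφ| ≤ C_L`;
`0 < τ < T`. If on every sub-window `(T−τ, t₁)`, `t₁ < T`, the release is `≤ Rel`, the local mass
`∫_{B_R}|u(t)|² ≤ a` on `[T−τ,T)`, the cubic integral `∬|u|³ ≤ m₃` and the gauged pressure integral
`∬|p − c(t)||u| ≤ m_{pu}` (integrable), then
`∫⁻_{(T−τ,T)}∫⁻_{B_ρ(x₀)} |∇u|²_F ≤ (Rel + νC_L a τ + C_g m₃ + 2C_g m_{pu})/(2ν)`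
(`dissipation_le_window` on `[T−τ,t₁]` and the exhaustion `t₁ ↑ T`; nothing is assumed at `T`).
[cite: CaffarelliKohnNirenberg1982, §2 (2.5)] -/
theorem terminalLocalDissipation_le {ν T : ℝ} (hν : 0 < ν)
    {u : ℝ → EuclideanSpace ℝ (Fin 3) → EuclideanSpace ℝ (Fin 3)}
    {p : ℝ → EuclideanSpace ℝ (Fin 3) → ℝ}
    (hcl : IsClassicalNSSolutionOn (Set.Ico 0 T) ν 0 u p)
    {φ : EuclideanSpace ℝ (Fin 3) → ℝ} (hφ : ContDiff ℝ ∞ φ) (hφc : HasCompactSupport φ)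
    (hφ0 : ∀ x, 0 ≤ φ x) {x₀ : EuclideanSpace ℝ (Fin 3)} {ρ R Cg CL : ℝ}
    (hone : ∀ x ∈ ball x₀ ρ, φ x = 1) (hsupp : tsupport φ ⊆ ball x₀ R)
    (hD : ∀ x, ‖fderiv ℝ φ x‖ ≤ Cg) (hΔ : ∀ x, |(Δ φ) x| ≤ CL) (hCg : 0 ≤ Cg)
    {τ : ℝ} (hτ : 0 < τ) (hτT : τ < T) {a Rel m₃ mpu : ℝ} {c : ℝ → ℝ}
    (ha : ∀ s ∈ Ico (T - τ) T, ∫ x in ball x₀ R, ‖u s x‖ ^ 2 ≤ a)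
    (hrel : ∀ t₁ ∈ Ioo (T - τ) T,
      (∫ x, φ x * ‖u (T - τ) x‖ ^ 2) - ∫ x, φ x * ‖u t₁ x‖ ^ 2 ≤ Rel)
    (h3 : ∀ t₁ ∈ Ioo (T - τ) T, ∫ z in Ioo (T - τ) t₁ ×ˢ ball x₀ R, ‖u z.1 z.2‖ ^ 3 ≤ m₃)
    (hq : ∀ t₁ ∈ Ioo (T - τ) T, IntegrableOn
      (fun z : ℝ × EuclideanSpace ℝ (Fin 3) => |p z.1 z.2 - c z.1| * ‖u z.1 z.2‖)
      (Ioo (T - τ) t₁ ×ˢ ball x₀ R))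
    (hpu : ∀ t₁ ∈ Ioo (T - τ) T,
      ∫ z in Ioo (T - τ) t₁ ×ˢ ball x₀ R, |p z.1 z.2 - c z.1| * ‖u z.1 z.2‖ ≤ mpu) :
    ∫⁻ t in Ioo (T - τ) T, ∫⁻ x in ball x₀ ρ,
        ENNReal.ofReal (frobeniusNormSq (fderiv ℝ (u t) x)) ≤
      ENNReal.ofReal ((Rel + (ν * CL * a * τ + Cg * m₃ + 2 * Cg * mpu)) / (2 * ν)) := by
  have h0 : 0 < T - τ := by linarith
  have hS' : IsClassicalNSSolutionOn (Ioo 0 T) ν 0 u p :=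
    hcl.mono Ioo_subset_Ico_self (uniqueDiffOn_Ioo 0 T)
  have hCL : 0 ≤ CL := (abs_nonneg _).trans (hΔ x₀)
  have ha0 : 0 ≤ a :=
    le_trans (integral_nonneg fun x => by positivity) (ha (T - τ) ⟨le_rfl, by linarith⟩)
  -- the localised dissipation as a function of time
  set G : ℝ → ℝ := fun s => ∫ x, frobeniusNormSq (fderiv ℝ (u s) x) * φ x with hGdef
  have hG0 : ∀ s, 0 ≤ G s := fun s =>
    integral_nonneg fun x => mul_nonneg (frobeniusNormSq_nonneg _) (hφ0 x)
  have cG : ContinuousOn G (Ioo 0 T) :=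
    hS'.continuousOn_integral_dissipation_cutoff isOpen_Ioo hφ.continuous hφc
  -- the bound on every sub-window
  have key : ∀ t₁ ∈ Ioo (T - τ) T,
      ∫⁻ t in Ioo (T - τ) t₁, ∫⁻ x in ball x₀ ρ,
          ENNReal.ofReal (frobeniusNormSq (fderiv ℝ (u t) x)) ≤
        ENNReal.ofReal ((Rel + (ν * CL * a * τ + Cg * m₃ + 2 * Cg * mpu)) / (2 * ν)) := by
    intro t₁ ht₁
    have hI : Icc (T - τ) t₁ ⊆ Ioo 0 T := fun s hs => ⟨h0.trans_le hs.1, hs.2.trans_lt ht₁.2⟩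
    have ht₀₁ : T - τ ≤ t₁ := ht₁.1.le
    have ha' : ∀ s ∈ Icc (T - τ) t₁, ∫ x in ball x₀ R, ‖u s x‖ ^ 2 ≤ a :=
      fun s hs => ha s ⟨hs.1, hs.2.trans_lt ht₁.2⟩
    have hdis := dissipation_le_window hS' isOpen_Ioo hν.le hφ hφc hsupp hD hΔ hCg ht₀₁ hI ha'
      (h3 t₁ ht₁) (hq t₁ ht₁) (hpu t₁ ht₁)
    -- the real bound on `∫_{T-τ}^{t₁} G`
    have hGle : ∫ s in (T - τ)..t₁, G s ≤
        (Rel + (ν * CL * a * τ + Cg * m₃ + 2 * Cg * mpu)) / (2 * ν) := by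
      rw [le_div_iff₀ (by positivity)]
      have hwin : ν * CL * a * (t₁ - (T - τ)) ≤ ν * CL * a * τ :=
        mul_le_mul_of_nonneg_left (by linarith [ht₁.2]) (by positivity)
      have hr := hrel t₁ ht₁
      have hG' : ∫ s in (T - τ)..t₁, G s = ∫ s in (T - τ)..t₁,
          ∫ x, frobeniusNormSq (fderiv ℝ (u s) x) * φ x := rfl
      linarith
    -- `G` is integrable and nonnegative on the sub-window
    have iG : IntegrableOn G (Ioo (T - τ) t₁) :=
      ((cG.mono hI).integrableOn_compact isCompact_Icc).mono_set Ioo_subset_Icc_self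
    have hGint : ∫ s in (T - τ)..t₁, G s = ∫ s in Ioo (T - τ) t₁, G s := by
      rw [intervalIntegral.integral_of_le ht₀₁, integral_Ioc_eq_integral_Ioo]
    -- slice comparison: `∫⁻_{B_ρ} ofReal |∇u(s)|² ≤ ofReal (G s)`
    have hslice : ∀ s ∈ Ioo (T - τ) t₁,
        ∫⁻ x in ball x₀ ρ, ENNReal.ofReal (frobeniusNormSq (fderiv ℝ (u s) x)) ≤
          ENNReal.ofReal (G s) := by
      intro s hs
      have hsS : s ∈ Ioo 0 T := hI (Ioo_subset_Icc_self hs)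
      have hC1 : ContDiff ℝ 1 (u s) := (hS'.contDiff_velocity hsS).of_le (by norm_cast)
      have hgc : Continuous fun x => frobeniusNormSq (fderiv ℝ (u s) x) * φ x :=
        (LerayHopfProofs.continuous_frobeniusNormSq.comp (hC1.continuous_fderiv one_ne_zero)).mul
          hφ.continuous
      have hgs : HasCompactSupport fun x => frobeniusNormSq (fderiv ℝ (u s) x) * φ x :=
        hφc.mul_left
      have hgi : Integrable (fun x => frobeniusNormSq (fderiv ℝ (u s) x) * φ x) :=
        hgc.integrable_of_hasCompactSupport hgs
      have hgnn : ∀ x, 0 ≤ frobeniusNormSq (fderiv ℝ (u s) x) * φ x :=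
        fun x => mul_nonneg (frobeniusNormSq_nonneg _) (hφ0 x)
      calc ∫⁻ x in ball x₀ ρ, ENNReal.ofReal (frobeniusNormSq (fderiv ℝ (u s) x))
          = ∫⁻ x in ball x₀ ρ, ENNReal.ofReal (frobeniusNormSq (fderiv ℝ (u s) x) * φ x) := by
            refine setLIntegral_congr_fun measurableSet_ball fun x hx => ?_
            rw [hone x hx, mul_one]
        _ ≤ ∫⁻ x, ENNReal.ofReal (frobeniusNormSq (fderiv ℝ (u s) x) * φ x) :=
            lintegral_mono' Measure.restrict_le_self le_rfl
        _ = ENNReal.ofReal (G s) := by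
            rw [hGdef]
            exact (ofReal_integral_eq_lintegral_ofReal hgi (Eventually.of_forall hgnn)).symm
    calc ∫⁻ t in Ioo (T - τ) t₁, ∫⁻ x in ball x₀ ρ,
            ENNReal.ofReal (frobeniusNormSq (fderiv ℝ (u t) x))
        ≤ ∫⁻ t in Ioo (T - τ) t₁, ENNReal.ofReal (G t) := setLIntegral_mono' measurableSet_Ioo hslice
      _ = ENNReal.ofReal (∫ t in Ioo (T - τ) t₁, G t) :=
          (ofReal_integral_eq_lintegral_ofReal iG (Eventually.of_forall hG0)).symm
      _ ≤ ENNReal.ofReal ((Rel + (ν * CL * a * τ + Cg * m₃ + 2 * Cg * mpu)) / (2 * ν)) := by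
          rw [← hGint]
          exact ENNReal.ofReal_le_ofReal hGle
  -- exhaustion `t₁ ↑ T`
  set tseq : ℕ → ℝ := fun n => T - τ / ((n : ℝ) + 2) with htseq
  have hmem : ∀ n, tseq n ∈ Ioo (T - τ) T := by
    intro n
    have hn : (0 : ℝ) < (n : ℝ) + 2 := by positivity
    constructor
    · have : τ / ((n : ℝ) + 2) < τ := by
        rw [div_lt_iff₀ hn]; nlinarith
      simp only [htseq]; linarith
    · have : 0 < τ / ((n : ℝ) + 2) := by positivity
      simp only [htseq]; linarith
  have hmono : Monotone fun n => Ioo (T - τ) (tseq n) := by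
    intro m n hmn
    refine Ioo_subset_Ioo_right ?_
    simp only [htseq]
    have hm : (0 : ℝ) < (m : ℝ) + 2 := by positivity
    have hle : (m : ℝ) + 2 ≤ (n : ℝ) + 2 := by exact_mod_cast Nat.add_le_add_right hmn 2
    have := div_le_div_of_nonneg_left hτ.le hm hle
    linarith
  have hunion : (⋃ n, Ioo (T - τ) (tseq n)) = Ioo (T - τ) T := by
    refine Subset.antisymm (iUnion_subset fun n => Ioo_subset_Ioo_right (hmem n).2.le) ?_
    intro s hs
    obtain ⟨n, hn⟩ := exists_nat_gt (τ / (T - s))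
    have hTs : 0 < T - s := by linarith [hs.2]
    refine mem_iUnion.2 ⟨n, hs.1, ?_⟩
    simp only [htseq]
    have hn2 : (0 : ℝ) < (n : ℝ) + 2 := by positivity
    have h1 : τ / ((n : ℝ) + 2) < T - s := by
      rw [div_lt_iff₀ hn2]
      rw [div_lt_iff₀ hTs] at hn
      nlinarith
    linarith
  rw [← hunion, setLIntegral_iUnion_of_directed _ hmono.directed_le]
  exact iSup_le fun n => key (tseq n) (hmem n)

/-- ★ **The LOCAL scar–modulus trade-off with the dissipation discharged by the local energy
budget.** Classical Leray–Hopf frame (`[0,T)` classical, Leray–Hopf on `[0,T]`; decay carried,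
unused); window modulus `∫|u(t)−u(T)|² ≤ H` on `[T−τ,T)`, `0 < τ < T`; radii `0 < r`, `4r ≤ ρ`; a
cut-off `φ ∈ C_c^∞`, `0 ≤ φ ≤ 1`, `φ = 1` on `B_ρ(x₀)`, `tsupport φ ⊆ B_R(x₀)`, `‖Dφ‖ ≤ C_g`,
`|Δφ| ≤ C_L`; budgets on every sub-window `(T−τ,t₁)`, `t₁ < T`: local mass `a`, cubic flux `m₃`,
gauged pressure flux `m_{pu}` (gauge `c(t)`). Then, with the universal `c₀` of STℓ,
`∫_{B_r(x₀)}|u(T)|² ≤ 2H + 16(r²/(ντ))·L + c₀(r/ρ)²(H + ∫_{B_ρ(x₀)}|u(T)|²)`,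
`L = ½·(4H + 4√H(2H + 2∫_{B_R(x₀)}|u(T)|²)^{1/2} + νC_L a τ + C_g m₃ + 2C_g m_{pu})`.
[folklore] -/
theorem scar_le_of_fluxBudget : ∃ c₀ : ℝ, 0 ≤ c₀ ∧
    ∀ (ν T : ℝ), 0 < ν → 0 < T →
    ∀ (u : ℝ → EuclideanSpace ℝ (Fin 3) → EuclideanSpace ℝ (Fin 3))
      (p : ℝ → EuclideanSpace ℝ (Fin 3) → ℝ),
      IsClassicalNSSolutionOn (Set.Ico 0 T) ν 0 u p →
      IsLerayHopfOn T ν 0 (u 0) u →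
      HasRapidSpatialDecay (u 0) →
      ∀ (x₀ : EuclideanSpace ℝ (Fin 3)) (r ρ R τ H : ℝ),
        0 < r → 4 * r ≤ ρ → 0 < τ → τ < T → 0 ≤ H →
        (∀ t ∈ Set.Ico (T - τ) T, ∫⁻ x, ‖u t x - u T x‖ₑ ^ 2 ≤ ENNReal.ofReal H) →
        ∀ (φ : EuclideanSpace ℝ (Fin 3) → ℝ) (Cg CL : ℝ), ContDiff ℝ ∞ φ → HasCompactSupport φ →
          (∀ x, 0 ≤ φ x) → (∀ x, φ x ≤ 1) → (∀ x ∈ ball x₀ ρ, φ x = 1) →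
          tsupport φ ⊆ ball x₀ R → (∀ x, ‖fderiv ℝ φ x‖ ≤ Cg) → (∀ x, |(Δ φ) x| ≤ CL) → 0 ≤ Cg →
        ∀ (a m₃ mpu : ℝ) (c : ℝ → ℝ),
          (∀ s ∈ Ico (T - τ) T, ∫ x in ball x₀ R, ‖u s x‖ ^ 2 ≤ a) →
          (∀ t₁ ∈ Ioo (T - τ) T, ∫ z in Ioo (T - τ) t₁ ×ˢ ball x₀ R, ‖u z.1 z.2‖ ^ 3 ≤ m₃) →
          (∀ t₁ ∈ Ioo (T - τ) T, IntegrableOn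
            (fun z : ℝ × EuclideanSpace ℝ (Fin 3) => |p z.1 z.2 - c z.1| * ‖u z.1 z.2‖)
            (Ioo (T - τ) t₁ ×ˢ ball x₀ R)) →
          (∀ t₁ ∈ Ioo (T - τ) T,
            ∫ z in Ioo (T - τ) t₁ ×ˢ ball x₀ R, |p z.1 z.2 - c z.1| * ‖u z.1 z.2‖ ≤ mpu) →
        ∫ x in ball x₀ r, ‖u T x‖ ^ 2 ≤
          2 * H + 16 * (r ^ 2 / (ν * τ)) *
              ((4 * H + 4 * Real.sqrt H * Real.sqrt (2 * H + 2 * ∫ x in ball x₀ R, ‖u T x‖ ^ 2) +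
                (ν * CL * a * τ + Cg * m₃ + 2 * Cg * mpu)) / 2) +
            c₀ * (r / ρ) ^ 2 * (H + ∫ x in ball x₀ ρ, ‖u T x‖ ^ 2) := by
  obtain ⟨c₀, hc₀, hST⟩ := LocalWindowTradeoff.localWindowTradeoff
  refine ⟨c₀, hc₀, ?_⟩
  intro ν T hν hT u p hcl hLH hdec x₀ r ρ R τ H hr hρ hτ hτT hH hmod φ Cg CL hφ hφc hφ0 hφ1 hone
    hsupp hD hΔ hCg a m₃ mpu c ha h3 hq hpu
  have h0 : 0 < T - τ := by linarith
  have hCL : 0 ≤ CL := (abs_nonneg _).trans (hΔ x₀)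
  have ha0 : 0 ≤ a :=
    le_trans (integral_nonneg fun x => by positivity) (ha (T - τ) ⟨le_rfl, by linarith⟩)
  -- a sub-window to read off `0 ≤ m₃`, `0 ≤ mpu`
  have htmid : T - τ / 2 ∈ Ioo (T - τ) T := ⟨by linarith, by linarith⟩
  have hm₃0 : 0 ≤ m₃ :=
    le_trans (integral_nonneg fun z => by positivity) (h3 _ htmid)
  have hmpu0 : 0 ≤ mpu :=
    le_trans (integral_nonneg fun z => by positivity) (hpu _ htmid)
  -- the release bound from the modulus
  have hmT : MemLp (u T) 2 volume := hLH.memLp T ⟨hT.le, le_rfl⟩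
  have hm0 : MemLp (u (T - τ)) 2 volume := hLH.memLp (T - τ) ⟨h0.le, by linarith⟩
  have hφzero : ∀ x, x ∉ ball x₀ R → φ x = 0 := fun x hx =>
    image_eq_zero_of_notMem_tsupport fun h' => hx (hsupp h')
  set Rel : ℝ := 4 * H + 4 * Real.sqrt H *
    Real.sqrt (2 * H + 2 * ∫ x in ball x₀ R, ‖u T x‖ ^ 2) with hRel
  have hRel0 : 0 ≤ Rel := by
    have : 0 ≤ Real.sqrt H * Real.sqrt (2 * H + 2 * ∫ x in ball x₀ R, ‖u T x‖ ^ 2) :=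
      mul_nonneg (Real.sqrt_nonneg _) (Real.sqrt_nonneg _)
    rw [hRel]; nlinarith
  have hrel : ∀ t₁ ∈ Ioo (T - τ) T,
      (∫ x, φ x * ‖u (T - τ) x‖ ^ 2) - ∫ x, φ x * ‖u t₁ x‖ ^ 2 ≤ Rel := by
    intro t₁ ht₁
    have hm1 : MemLp (u t₁) 2 volume := hLH.memLp t₁ ⟨(h0.trans ht₁.1).le, ht₁.2.le⟩
    exact release_le_of_modulus (u (T - τ)) (u t₁) (u T) hm0 hm1 hmT hφ.continuous hφ0 hφ1
      hφzero hH (hmod (T - τ) ⟨le_rfl, by linarith⟩) (hmod t₁ ⟨ht₁.1.le, ht₁.2⟩)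
  -- the terminal dissipation budget
  have hdiss := terminalLocalDissipation_le hν hcl hφ hφc hφ0 hone hsupp hD hΔ hCg hτ hτT
    ha hrel h3 hq hpu
  -- feed STℓ with `L = (Rel + budget)/2`
  set L : ℝ := (Rel + (ν * CL * a * τ + Cg * m₃ + 2 * Cg * mpu)) / 2 with hL
  have hL0 : 0 ≤ L := by rw [hL]; positivity
  have hLν : (Rel + (ν * CL * a * τ + Cg * m₃ + 2 * Cg * mpu)) / (2 * ν) = L / ν := by
    rw [hL]; field_simp
  rw [hLν] at hdiss
  exact hST ν T hν hT u p hcl hLH hdec x₀ r ρ τ H L hr hρ hτ hτT hH hL0 hmod hdiss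

end LocalEnergyBudget

end Summit.NavierStokesRegularity.NavierStokesRegularity.Theorems

end
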